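import Summits.BirchSwinnertonDyer.BirchSwinnertonDyer.Theorems.ResidualThetaTransportAtTwoThetaLayerLambdaCongruenceAtTwoDualChainCrossing
import HarnessLib

/-!
# Crux `ThetaLayerLambdaCongruenceAtTwo` (stmt-BirchSwinnertonDyer-20688, route ResidualThetaTransportAtTwo), line
# `birth` v13 — SD floor, brick S4 (part 6a): CLOSED WALKS IN THE QUOTIENT GRAPH `Γ₀(N)\(dual Farey tree)` LIFT to dual
# chains of elements of `Γ₀(N)` with the same crossing vector (width seat bsd-wall-rtt-p3-w2 g8;
# `--supports stmt-BirchSwinnertonDyer-20688 --as helper`; closes nothing)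

HONEST FRAMING. Elementary THEOREMS on lists of matrices and the coset space `SL₂(ℤ)/Γ₀(N)`; no definition; nothing about any
curve or form is asserted; BSD is not proved by any of this.

WHAT. A COSET WALK is a sequence `h : ℕ → SL₂(ℤ)` with `(h(k+1)S)⁻¹Γ₀ = (h(k)τʲ)⁻¹Γ₀` (some `j` each; `τ = ST⁻¹`): consecutive steps
share a triangle CLASS mod `Γ₀(N)` (a walk in the finite quotient graph, edges = cosets, written with representatives). The crossing
vector of a segment is `Σ (e_{h⁻¹Γ₀} − e_{(hS)⁻¹Γ₀})` (as in `…DualChain`).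
* `exists_lift_cosetWalk`: every segment `[h m, …, h(m+d−1)]` lifts to an HONEST walk in the dual tree from the triangle of `h(m)S` to
  the triangle of some `b` in the class where the next step starts, with the SAME crossing vector (lift `h ↦ −bτᵉS` step by step).
* `exists_dualChain_of_closed_cosetWalk`: if the walk returns to the same coset after `d` steps, there are `γ ∈ Γ₀(N)` and a dual
  chain `D` of `γ` (`…DualChain`) with the crossing vector of the segment — conjugate by a walk from the base triangle.
This is the path-lifting half of «`Γ₀(N) → H₁(Γ₀(N)\tree; ℤ)` is onto» (Serre, Trees, §I.5), used for the PERFECTNESS of the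
crossing pairing of `…CrossingPairing` (`Cruxes/…/Lines/birth-sd2-architecture.md`, brick S4).

References: J.-P. Serre, Trees, §I.4–I.5; [Manin1972] §1.5–1.7.
-/

set_option autoImplicit false

noncomputable section

-- justification: the `Summit.BirchSwinnertonDyer.BirchSwinnertonDyer.…` path repeats a component (route-file convention)
set_option linter.dupNamespace false

open scoped Classical MatrixGroups

open CongruenceSubgroup Matrix.SpecialLinearGroup ModularGroup
open Literature.NumberTheory.EllipticCurves.ModularForms

namespace Summit.BirchSwinnertonDyer.BirchSwinnertonDyer.Theorems.ThetaLayerLambdaCongruenceAtTwo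

section Lift

variable {N : ℕ}

/-- `(gm)⁻¹Γ₀(N) = m⁻¹·(g⁻¹Γ₀(N))`: right multiplication acts on the cosets `g⁻¹Γ₀(N)`. [folklore] -/
theorem coe_mul_inv_eq_smul (g m : SL(2, ℤ)) :
    (((g * m)⁻¹ : SL(2, ℤ)) : Gamma0Coset N) = m⁻¹ • ((g⁻¹ : SL(2, ℤ)) : Gamma0Coset N) := by
  rw [mul_inv_rev, MulAction.Quotient.smul_mk, smul_eq_mul]

/-- Cosets are compatible with right multiplication: `g⁻¹Γ₀ = h⁻¹Γ₀ ⇒ (gm)⁻¹Γ₀ = (hm)⁻¹Γ₀`. [folklore] -/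
theorem coe_mul_inv_congr {g h : SL(2, ℤ)} (e : ((g⁻¹ : SL(2, ℤ)) : Gamma0Coset N) = ((h⁻¹ : SL(2, ℤ)) : Gamma0Coset N))
    (m : SL(2, ℤ)) : (((g * m)⁻¹ : SL(2, ℤ)) : Gamma0Coset N) = (((h * m)⁻¹ : SL(2, ℤ)) : Gamma0Coset N) := by
  rw [coe_mul_inv_eq_smul, coe_mul_inv_eq_smul, e]

/-- A triangle function is invariant under right powers of `τ = ST⁻¹`. [folklore] -/
theorem apply_mul_tau_pow {A : Type} (G : SL(2, ℤ) → A) (hτ : ∀ x, G (x * (S * T⁻¹)) = G x) (x : SL(2, ℤ)) (j : ℕ) :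
    G (x * (S * T⁻¹) ^ j) = G x := by
  induction j with
  | zero => rw [pow_zero, mul_one]
  | succ n ih => rw [pow_succ, ← mul_assoc, hτ, ih]

/-- **Lifting a coset walk to the tree.** Let `h : ℕ → SL₂(ℤ)` be a COSET WALK: `(h(k+1)S)⁻¹Γ₀ = (h(k)τʲ)⁻¹Γ₀` for some `j ∈ ℕ` at
each `k` (consecutive steps share a triangle class mod `Γ₀(N)`). Then for all `m, d` the segment `[h m, …, h (m+d−1)]` lifts to an
HONEST walk `Dg` in the dual tree from the triangle of `a := h(m)S` to the triangle of some `b` with `(h(m+d)S)⁻¹Γ₀ = (bτᵉ)⁻¹Γ₀` (the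
next step starts at the class of `b`), with the same crossing vector. [cite: Manin1972, §1.5] -/
theorem exists_lift_cosetWalk (h : ℕ → SL(2, ℤ))
    (hconn : ∀ k : ℕ, ∃ j : ℕ, (((h (k + 1) * S)⁻¹ : SL(2, ℤ)) : Gamma0Coset N) = (((h k * (S * T⁻¹) ^ j)⁻¹ : SL(2, ℤ)) : Gamma0Coset N))
    (m d : ℕ) :
    ∃ (Dg : List SL(2, ℤ)) (b : SL(2, ℤ)) (e : ℕ),
      (∀ {A : Type} [AddCommGroup A] (G : SL(2, ℤ) → A), (∀ x, G (x * (S * T⁻¹)) = G x) → (∀ x, G (-x) = G x) →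
        (Dg.map fun g ↦ G g - G (g * S)).sum = G b - G (h m * S)) ∧
      (((h (m + d) * S)⁻¹ : SL(2, ℤ)) : Gamma0Coset N) = (((b * (S * T⁻¹) ^ e)⁻¹ : SL(2, ℤ)) : Gamma0Coset N) ∧
      (∀ q : Gamma0Coset N,
        (Dg.map fun g ↦ (Pi.single ((g⁻¹ : SL(2, ℤ)) : Gamma0Coset N) (1 : ℤ) -
          Pi.single (((g * S)⁻¹ : SL(2, ℤ)) : Gamma0Coset N) 1 : Gamma0Coset N → ℤ)).sum q =
        (((List.range d).map fun i ↦ h (m + i)).map fun g ↦ (Pi.single ((g⁻¹ : SL(2, ℤ)) : Gamma0Coset N) (1 : ℤ) -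
          Pi.single (((g * S)⁻¹ : SL(2, ℤ)) : Gamma0Coset N) 1 : Gamma0Coset N → ℤ)).sum q) := by
  induction d with
  | zero => exact ⟨[], h m * S, 0, fun G _ _ ↦ by simp, by rw [add_zero, pow_zero, mul_one], fun q ↦ by simp⟩
  | succ d ih =>
    obtain ⟨Dg, b, e, hsum, hnext, hvec⟩ := ih
    -- lift the step `h (m + d)` to `g := -(b τᵉ S)`
    set g : SL(2, ℤ) := -(b * (S * T⁻¹) ^ e * S) with hg
    have hgS : g * S = b * (S * T⁻¹) ^ e := by
      rw [hg, neg_mul, mul_assoc (b * (S * T⁻¹) ^ e), S_mul_S_eq_neg_one, mul_neg_one, neg_neg]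
    have hcg : ((g⁻¹ : SL(2, ℤ)) : Gamma0Coset N) = (((h (m + d))⁻¹ : SL(2, ℤ)) : Gamma0Coset N) := by
      have e1 : ((g⁻¹ : SL(2, ℤ)) : Gamma0Coset N) = S • (((b * (S * T⁻¹) ^ e)⁻¹ : SL(2, ℤ)) : Gamma0Coset N) := by
        rw [← hgS, coe_mul_S_inv, ← mul_smul, S_mul_S_eq_neg_one, neg_one_smul_coset]
      have e2 : (((h (m + d))⁻¹ : SL(2, ℤ)) : Gamma0Coset N) = S • (((h (m + d) * S)⁻¹ : SL(2, ℤ)) : Gamma0Coset N) := by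
        rw [coe_mul_S_inv, ← mul_smul, S_mul_S_eq_neg_one, neg_one_smul_coset]
      rw [e1, e2, hnext]
    obtain ⟨j, hj⟩ := hconn (m + d)
    refine ⟨Dg ++ [g], g, j, fun G hτ hn ↦ ?_, ?_, fun q ↦ ?_⟩
    · rw [List.map_append, List.sum_append, hsum G hτ hn, List.map_singleton, List.sum_singleton, hgS,
        apply_mul_tau_pow G hτ]
      abel
    · rw [show m + (d + 1) = m + d + 1 by ring, hj]
      exact coe_mul_inv_congr hcg.symm _
    · rw [List.range_succ, List.map_append, List.map_append, List.sum_append, List.map_append, List.sum_append, Pi.add_apply,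
        Pi.add_apply, hvec q]
      congr 1
      simp only [List.map_cons, List.map_nil, List.sum_cons, List.sum_nil, add_zero]
      rw [hcg, coe_mul_inv_congr hcg S]

/-- **Closed coset walks come from `Γ₀(N)`.** If the coset walk `h` returns to the same coset after `d ≥ 1` steps
(`(h(m+d))⁻¹Γ₀ = (h m)⁻¹Γ₀`), then there are `γ ∈ Γ₀(N)` and a dual chain `D` of `γ` (an honest closed walk in `X₀(N)` from the base
triangle to its `γ`-translate, `…DualChain`) with the crossing vector of the segment `[h m, …, h(m+d−1)]`. [cite: Manin1972, §1.5] -/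
theorem exists_dualChain_of_closed_cosetWalk (h : ℕ → SL(2, ℤ))
    (hconn : ∀ k : ℕ, ∃ j : ℕ, (((h (k + 1) * S)⁻¹ : SL(2, ℤ)) : Gamma0Coset N) = (((h k * (S * T⁻¹) ^ j)⁻¹ : SL(2, ℤ)) : Gamma0Coset N))
    (m d : ℕ) (hback : (((h (m + d))⁻¹ : SL(2, ℤ)) : Gamma0Coset N) = (((h m)⁻¹ : SL(2, ℤ)) : Gamma0Coset N)) :
    ∃ (γ : Gamma0 N) (D : List SL(2, ℤ)),
      (∀ {A : Type} [AddCommGroup A] (G : SL(2, ℤ) → A), (∀ x, G (x * (S * T⁻¹)) = G x) → (∀ x, G (-x) = G x) →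
        (D.map fun g ↦ G g - G (g * S)).sum = G (γ : SL(2, ℤ)) - G 1) ∧
      (∀ q : Gamma0Coset N,
        (D.map fun g ↦ (Pi.single ((g⁻¹ : SL(2, ℤ)) : Gamma0Coset N) (1 : ℤ) -
          Pi.single (((g * S)⁻¹ : SL(2, ℤ)) : Gamma0Coset N) 1 : Gamma0Coset N → ℤ)).sum q =
        (((List.range d).map fun i ↦ h (m + i)).map fun g ↦ (Pi.single ((g⁻¹ : SL(2, ℤ)) : Gamma0Coset N) (1 : ℤ) -
          Pi.single (((g * S)⁻¹ : SL(2, ℤ)) : Gamma0Coset N) 1 : Gamma0Coset N → ℤ)).sum q) := by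
  obtain ⟨Dg, b, e, hsum, hnext, hvec⟩ := exists_lift_cosetWalk h hconn m d
  set a : SL(2, ℤ) := h m * S with ha
  -- `(b τᵉ)⁻¹Γ₀ = a⁻¹Γ₀`, so `γ := b τᵉ a⁻¹ ∈ Γ₀(N)`
  have hba : (((b * (S * T⁻¹) ^ e)⁻¹ : SL(2, ℤ)) : Gamma0Coset N) = ((a⁻¹ : SL(2, ℤ)) : Gamma0Coset N) := by
    rw [← hnext, ha]
    exact coe_mul_inv_congr hback S
  have hγmem : b * (S * T⁻¹) ^ e * a⁻¹ ∈ Gamma0 N := by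
    rw [QuotientGroup.eq, inv_inv] at hba
    exact hba
  obtain ⟨Da, hDa⟩ := exists_dualChain a
  refine ⟨⟨b * (S * T⁻¹) ^ e * a⁻¹, hγmem⟩, Da ++ Dg ++ (Da.map fun g ↦ g * S).map fun g ↦ (b * (S * T⁻¹) ^ e * a⁻¹) * g,
    fun G hτ hn ↦ ?_, fun q ↦ ?_⟩
  · rw [List.map_append, List.map_append, List.sum_append, List.sum_append, hDa G hτ hn, hsum G hτ hn, List.map_map, List.map_map]
    have h2 := hDa (fun g ↦ G ((b * (S * T⁻¹) ^ e * a⁻¹) * g)) (fun g ↦ by rw [← mul_assoc, hτ])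
      (fun g ↦ by simp only [mul_neg, hn])
    have ecomp : (Da.map (((fun x ↦ G x - G (x * S)) ∘ fun g ↦ (b * (S * T⁻¹) ^ e * a⁻¹) * g) ∘ fun g ↦ g * S)).sum =
        -(Da.map fun g ↦ G ((b * (S * T⁻¹) ^ e * a⁻¹) * g) - G ((b * (S * T⁻¹) ^ e * a⁻¹) * (g * S))).sum := by
      rw [List.sum_neg, List.map_map]
      congr 1
      refine List.map_congr_left fun g _ ↦ ?_
      have e3 : (b * (S * T⁻¹) ^ e * a⁻¹) * (g * S) * S = -((b * (S * T⁻¹) ^ e * a⁻¹) * g) := by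
        rw [mul_assoc, mul_assoc g, S_mul_S_eq_neg_one, mul_neg_one, mul_neg]
      simp only [Function.comp_apply]
      rw [e3, hn, neg_sub]
    rw [ecomp, h2, mul_one, inv_mul_cancel_right, apply_mul_tau_pow G hτ]
    change _ = G (b * (S * T⁻¹) ^ e * a⁻¹) - G 1
    abel
  · rw [List.map_append, List.map_append, List.sum_append, List.sum_append, Pi.add_apply, Pi.add_apply, hvec q,
      dualChainVec_map_mul_left ⟨_, hγmem⟩, dualChainVec_map_mul_S]
    abel

end Lift

end Summit.BirchSwinnertonDyer.BirchSwinnertonDyer.Theorems.ThetaLayerLambdaCongruenceAtTwo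

end
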